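import Literature.NumberTheory.EllipticCurves.ManinConstantGamma1ModularDegree
import Literature.NumberTheory.EllipticCurves.ModularCurveRealPeriodProofs
import Literature.NumberTheory.EllipticCurves.RealLatticeCovolumeProofs
import Literature.NumberTheory.EllipticCurves.LatticeInclusionIsogenyDegreeProofs
import Literature.NumberTheory.EllipticCurves.IsogenyDualProofs
import Literature.NumberTheory.EllipticCurves.ManinConstantSemistablePrimewise
import Literature.NumberTheory.EllipticCurves.Greenberg1999.TwoTorsionMuInvariant
import Literature.NumberTheory.EllipticCurves.Rank1Residual.Predicates
import Literature.NumberTheory.EllipticCurves.NonEisensteinPrimeOfSurjective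
import Literature.Uncategorized.OrdPublishedInputsAtTwo
import HarnessLib

/-!
# Triage r1-1 (GEN 10 → GEN 11) — `stub_periodDescentOfEisenstein` (β) via the `X₁(N)`-optimal curve

GEN 11 (v2 of this workfile, seat 1): adds the last section `### GEN 11 — the registered stub
VERBATIM modulo T2`: the print-existence statement `Gamma1OptimalDatumExists` (T2, a `def … : Prop`
with body: Stevens' `X₁(N)`-optimal curve of the class of `E₀` rendered as a `Γ₁(N)`-datum with the
same newform and `X₁(N)`-optimal lattice `Λ_{W₁} ⊆ c₁Λ₁(f)`; `c₁ ∈ ℤ` is Gabber's integrality,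
Česnavičius–Neururer–Saha 2024 §1 / Lemma `const-in-Z`, any `Γ₁(N) ⊂ Γ ⊂ Γ₀(N)`) and the theorem
`stub_periodDescentOfEisenstein_of_T2 : Gamma1OptimalDatumExists → ‹type of the v11 stub, verbatim›`
(sorry-free; `2 ∤ N` from `GoodOrd E₀ 2` by `not_dvd_conductorNorm_of_hasGoodReductionAtPrime`,
`2 ∤ c₀` from the Abbes–Ullmo binder the stub itself carries and its own lattice-optimality
hypothesis). So skeleton v11's (β) is T2 + kernel glue; the hypotheses PUB, `¬CM`, `analyticRank = 0`,
the `2`-torsion member and the ordinarity half of `GoodOrd` are unused. BSD is not proved here and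
no Theses decl is asserted.

Kernel-checked lattice route [R2] of `TRIAGE-r1-1.md` §GEN 10 for the (β) stub of the picked line
`Lines/kato_free_lower_sandwich_two.lean` (v9). Findings, all sorry-free:

* `two_pow_dvd_of_gamma1`, `re_periodLatticeGamma1_of_eisenstein`: an integer period functional
  `m` of `f` (`re {∞,γ∞}_f = m(γ) Ω⁺_f/2`) that is Eisenstein mod `2^{s+1}` (factors through
  `γ ↦ d mod N`) vanishes mod `2^{s+1}` on `Γ₁(N)` (`d ≡ 1`, `m(1) = 0`), hence
  `re Λ₁(f) ⊆ 2^{s} Ω⁺_f ℤ`.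
* `rhombicHalf_holds`: a real lattice with `disc < 0` has a point of real part `Ω₀/2` (from the
  tree's `IsReal.discr_pos_of_half_sum_notMem`); with the rectangular case this gives
  `Ω(W)/2 ∈ re Λ_W` for every `Γ₁`-datum (`g1_exists_re_eq_half`).
* `periodDescent_of_gamma1Optimal` + `isIsogenous_of_gamma1Optimal`: for ANY `Γ₁(N)`-datum `D₁`
  of a curve `W₁` with the same newform as `E₀` and `X₁(N)`-optimal lattice `Λ_{W₁} ⊆ c₁Λ₁(f)`
  (Stevens 1989 §2: the `X₁(N)`-optimal curve; `c₁ ∈ ℤ` by Gabber/ČNS), and `c₀ = c(D₀)` odd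
  (Abbes–Ullmo at `2 ∤ N`): `E₀ ~ W₁` over `ℚ` and `Ω(W₁) = r Ω(E₀)` with `v₂(r) ≥ s+1` — the
  conclusion of (β) with `W₃ := W₁`, for EVERY depth `s`, at EVERY level (prime or composite),
  using none of `¬CM`, `rank 0`, `GoodOrd` (beyond `2 ∤ N`), or the `2`-torsion habitat.

Consequence for the line: (β) is not research-open; it reduces to the print-existence stub
T2 «the `X₁(N)`-optimal curve: `∃ W₁` globally minimal elliptic, `D₁ : Gamma1ParametrizationData W₁ N`,
`D₁.f = D₀.f`, `∀ z ∈ D₁.L.lattice, ∃ w ∈ Λ₁(f), z = D₁.c w`» (Stevens 1989, (2.?)/§2; shared with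
crux 27047's T2) plus `GoodOrd E₀ 2 → 2 ∤ N → 2 ∤ c₀` (AU, by name). Triage artefact
(idea-level `.lean`), not a line skeleton; no stub of the picked line is restated. BSD is not
proved here.
-/

set_option linter.dupNamespace false

open scoped MatrixGroups ModularForm
open CongruenceSubgroup Complex WeierstrassCurve Literature.NumberTheory.EllipticCurves

namespace Summit.BirchSwinnertonDyer.BirchSwinnertonDyer.Cruxes.OrdMissingLowerBoundAtTwo.TriageR11BetaViaE1

open Literature.NumberTheory.EllipticCurves.ModularForms

variable {N : ℕ} (f : CuspForm (Gamma0 N) 2)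

/-- `d ≡ 1 (mod N)` on `Γ₁(N)`: the `Γ₀(N) → (ℤ/N)`, `γ ↦ d` map is trivial on `Γ₁(N)`. [folklore] -/
theorem gamma0Map_of_gamma1 (γ : Gamma1 N) :
    Gamma0Map N ⟨(γ : SL(2, ℤ)), Gamma1_in_Gamma0 N γ.2⟩ = 1 := by
  have h := (Gamma1_mem N (γ : SL(2, ℤ))).mp γ.2
  simp only [Gamma0Map, MonoidHom.coe_mk, OneHom.coe_mk]
  exact h.2.1

/-- **Step 1–2.** If the integer period functional `m` (`re {∞,γ∞}_f = m(γ) Ω⁺_f/2`) is Eisenstein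
mod `2^{s+1}` (factors through `γ ↦ d mod N`), then `2^{s+1} ∣ m(γ)` for every `γ ∈ Γ₁(N)`:
`m(γ) ≡ χ(d(γ)) = χ(d(1)) ≡ m(1) = 0` since `{∞, 1∞}_f = 0` and `Ω⁺_f ≠ 0`. [folklore] -/
theorem two_pow_dvd_of_gamma1 (hΩ : plusPeriod f ≠ 0) (s : ℕ) (m : Gamma0 N → ℤ)
    (hm : ∀ γ, (cuspSymbol f γ).re = m γ * (plusPeriod f / 2))
    (χ : ZMod N → ZMod (2 ^ (s + 1)))
    (hχ : ∀ γ, ((m γ : ℤ) : ZMod (2 ^ (s + 1))) = χ (Gamma0Map N γ))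
    (γ : Gamma1 N) :
    (2 : ℤ) ^ (s + 1) ∣ m ⟨(γ : SL(2, ℤ)), Gamma1_in_Gamma0 N γ.2⟩ := by
  have h1 : m 1 = 0 := by
    have h := hm 1
    rw [cuspSymbol_one, Complex.zero_re] at h
    have hne : (plusPeriod f / 2 : ℝ) ≠ 0 := div_ne_zero hΩ two_ne_zero
    have : (m 1 : ℝ) = 0 := by
      by_contra hm1
      exact (mul_ne_zero hm1 hne) h.symm
    exact_mod_cast this
  have hγ := hχ ⟨(γ : SL(2, ℤ)), Gamma1_in_Gamma0 N γ.2⟩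
  rw [gamma0Map_of_gamma1, ← map_one (Gamma0Map N), ← hχ 1, h1, Int.cast_zero] at hγ
  have hγ' : (((2 ^ (s + 1) : ℕ) : ℤ) ∣ m ⟨(γ : SL(2, ℤ)), Gamma1_in_Gamma0 N γ.2⟩) :=
    (ZMod.intCast_zmod_eq_zero_iff_dvd _ _).mp hγ
  simpa using hγ'

/-- **Step 3.** Under the same hypotheses every `z ∈ Λ₁(f)` has `re z ∈ 2^{s+1}(Ω⁺_f/2)ℤ =
2^{s} Ω⁺_f ℤ` (closure induction on the generators `{∞, γ∞}_f`, `γ ∈ Γ₁(N)`). [folklore] -/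
theorem re_periodLatticeGamma1_of_eisenstein (hΩ : plusPeriod f ≠ 0) (s : ℕ) (m : Gamma0 N → ℤ)
    (hm : ∀ γ, (cuspSymbol f γ).re = m γ * (plusPeriod f / 2))
    (χ : ZMod N → ZMod (2 ^ (s + 1)))
    (hχ : ∀ γ, ((m γ : ℤ) : ZMod (2 ^ (s + 1))) = χ (Gamma0Map N γ))
    {z : ℂ} (hz : z ∈ periodLatticeGamma1 f) :
    ∃ n : ℤ, z.re = n * (2 ^ (s + 1) * (plusPeriod f / 2)) := by
  have hz' : z ∈ AddSubgroup.closure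
      (Set.range fun γ : Gamma1 N ↦ cuspSymbol f ⟨(γ : SL(2, ℤ)), Gamma1_in_Gamma0 N γ.2⟩) := hz
  induction hz' using AddSubgroup.closure_induction with
  | mem x hx =>
    obtain ⟨γ, rfl⟩ := hx
    obtain ⟨k, hk⟩ := two_pow_dvd_of_gamma1 f hΩ s m hm χ hχ γ
    refine ⟨k, ?_⟩
    rw [hm, hk]
    push_cast
    ring
  | zero => exact ⟨0, by simp⟩
  | add x y hx0 hy0 hx hy =>
    obtain ⟨a, ha⟩ := hx hx0
    obtain ⟨b, hb⟩ := hy hy0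
    exact ⟨a + b, by rw [Complex.add_re, ha, hb]; push_cast; ring⟩
  | neg x hx0 hx =>
    obtain ⟨a, ha⟩ := hx hx0
    exact ⟨-a, by rw [Complex.neg_re, ha]; push_cast; ring⟩

/-- **Step 4–5.** If a lattice `Λ ⊆ ℂ` lies in `c₁ Λ₁(f)` (`X₁(N)`-optimality: `Λ_{E₁} = c₁Λ₁(f)`,
Stevens 1989 §2, `c₁ = c_φ ∈ ℤ` by Gabber/ČNS) and its real period `Ω₁` has `Ω₁/2 ∈ re Λ`
(rectangular case: `Ω₁ = 2Ω₀`, `Ω₀ ∈ Λ`; rhombic case: `Ω₁ = Ω₀` and `(Ω₀ + ω₂)/2`-type element —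
lemma (M-rhombic)), then `Ω₁ ∈ c₁ 2^{s+1} Ω⁺_f ℤ`. [folklore] -/
theorem realPeriod_eq_of_sublattice (hΩ : plusPeriod f ≠ 0) (s : ℕ) (m : Gamma0 N → ℤ)
    (hm : ∀ γ, (cuspSymbol f γ).re = m γ * (plusPeriod f / 2))
    (χ : ZMod N → ZMod (2 ^ (s + 1)))
    (hχ : ∀ γ, ((m γ : ℤ) : ZMod (2 ^ (s + 1))) = χ (Gamma0Map N γ))
    (Λ : Set ℂ) (c₁ : ℤ) (hΛ : ∀ z ∈ Λ, ∃ w ∈ periodLatticeGamma1 f, z = c₁ * w)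
    (Ω₁ : ℝ) (hhalf : ∃ z ∈ Λ, z.re = Ω₁ / 2) :
    ∃ j : ℤ, Ω₁ = j * (c₁ * 2 ^ (s + 1) * plusPeriod f) := by
  obtain ⟨z, hz, hzre⟩ := hhalf
  obtain ⟨w, hw, rfl⟩ := hΛ z hz
  obtain ⟨n, hn⟩ := re_periodLatticeGamma1_of_eisenstein f hΩ s m hm χ hχ hw
  refine ⟨n, ?_⟩
  have h2 : Ω₁ = 2 * (((c₁ : ℂ) * w).re) := by rw [hzre]; ring
  rw [h2, Complex.mul_re, Complex.intCast_re, Complex.intCast_im, hn]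
  ring

/-- **Step 6–7 (valuation arithmetic).** From `Ω₁ = j c₁ 2^{s+1} Ω⁺_f`, the `X₀(N)`-period
relation `m₀ Ω(E₀) = |c₀| Ω⁺_f` (`realPeriodRat_dvd_holds`) with `c₀` odd (Abbes–Ullmo at `2 ∤ N`)
and `Ω₁ ≠ 0`: `Ω₁ = r Ω(E₀)` with `r = j c₁ m₀ 2^{s+1}/|c₀| ∈ ℚ`, `v₂(r) ≥ s+1`. [folklore] -/
theorem padicValRat_ratio_ge (s : ℕ) (Ωf Ω₀ Ω₁ : ℝ) (j c₁ c₀ m₀ : ℤ)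
    (h1 : Ω₁ = j * (c₁ * 2 ^ (s + 1) * Ωf)) (h0 : (m₀ : ℝ) * Ω₀ = |(c₀ : ℝ)| * Ωf)
    (hc₀ : ¬ (2 : ℤ) ∣ c₀) (hΩ₁ : Ω₁ ≠ 0) :
    ∃ r : ℚ, Ω₁ = (r : ℝ) * Ω₀ ∧ ((s : ℤ) + 1) ≤ padicValRat 2 r := by
  have hc₀0 : c₀ ≠ 0 := by rintro rfl; exact hc₀ (dvd_zero 2)
  have habs : (|c₀| : ℤ) ≠ 0 := abs_ne_zero.mpr hc₀0
  have hjcm : j * c₁ ≠ 0 := by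
    intro h
    apply hΩ₁
    have h' : (j : ℝ) * c₁ = 0 := by exact_mod_cast h
    rw [h1]
    calc (j : ℝ) * (c₁ * 2 ^ (s + 1) * Ωf) = ((j : ℝ) * c₁) * (2 ^ (s + 1) * Ωf) := by ring
      _ = 0 := by rw [h', zero_mul]
  have hΩf : Ωf = (m₀ : ℝ) * Ω₀ / |(c₀ : ℝ)| := by
    have : (|(c₀ : ℝ)|) ≠ 0 := by exact_mod_cast (abs_ne_zero.mpr (Int.cast_ne_zero.mpr hc₀0) :
      |(c₀:ℝ)| ≠ 0)
    field_simp
    linarith [h0]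
  have hm₀ : m₀ ≠ 0 := by
    intro h
    apply hΩ₁
    rw [h1, hΩf, h]
    simp
  refine ⟨((j * c₁ * m₀ : ℤ) : ℚ) * (2 : ℚ) ^ (s + 1) / ((|c₀| : ℤ) : ℚ), ?_, ?_⟩
  · rw [h1, hΩf]
    push_cast
    rw [← Int.cast_abs]
    ring
  · have hq1 : ((j * c₁ * m₀ : ℤ) : ℚ) ≠ 0 := by exact_mod_cast mul_ne_zero hjcm hm₀
    have hq2 : ((2 : ℚ) ^ (s + 1)) ≠ 0 := pow_ne_zero _ two_ne_zero
    have hq3 : (((|c₀| : ℤ)) : ℚ) ≠ 0 := by exact_mod_cast habs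
    have h22 : padicValRat 2 2 = 1 := by simpa using padicValRat.self (p := 2) one_lt_two
    have h0' : padicValInt 2 |c₀| = 0 :=
      padicValInt.eq_zero_of_not_dvd (p := 2) (by rwa [Nat.cast_ofNat, dvd_abs])
    rw [padicValRat.div (mul_ne_zero hq1 hq2) hq3, padicValRat.mul hq1 hq2, padicValRat.pow (2 : ℚ),
      padicValRat.of_int, padicValRat.of_int, h22, h0']
    push_cast
    have : (0 : ℤ) ≤ (padicValInt 2 (j * c₁ * m₀) : ℤ) := by positivity
    linarith


/-! ### Assembly: (β) for an `X₁(N)`-lattice-optimal datum, modulo the rhombic half-period lemma -/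

/-- **(M-rhombic), hypothesis.** For a real lattice with negative discriminant (rhombic case,
`Λ = ⟨Ω₀, (Ω₀ + iΩ₀')/2⟩`), some lattice point has real part `Ω₀/2` (Cremona §2.8, p. 26; Lawden
§6.16). The tree has the two `⊆` halves (`IsReal.exists_re_eq_int_mul_half`,
`IsReal.exists_re_eq_int_mul_of_discr_pos`); the existence half is `rhombicHalf_holds` below.
[cite: CremonaAlgorithms1997, §2.8 (p. 26)] -/
def RhombicHalf : Prop :=
  ∀ L : PeriodPair, L.IsReal → L.g₂.re ^ 3 - 27 * L.g₃.re ^ 2 < 0 →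
    ∃ z ∈ L.lattice, z.re = L.minRealPeriod / 2

/-- **(M-rhombic) holds**: by `IsReal.discr_pos_of_half_sum_notMem` (rectangular ⇒ `disc > 0`,
file `RealLatticeCovolumeProofs`), a real lattice with `disc < 0` contains `(Ω₀ + iΩ₀')/2`, whose
real part is `Ω₀/2` (Cremona §2.10, p. 30; Lawden §6.16). [cite: CremonaAlgorithms1997, §2.10 (p. 30)] -/
theorem rhombicHalf_holds : RhombicHalf := by
  intro L h hneg
  by_cases hcase :
      ((L.minRealPeriod : ℂ) + I * (L.mulLeft I I_ne_zero).minRealPeriod) / 2 ∈ L.lattice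
  · refine ⟨_, hcase, ?_⟩
    simp [Complex.add_re, Complex.mul_re]
  · exact absurd (h.discr_pos_of_half_sum_notMem hneg.ne hcase) (not_lt.mpr hneg.le)

section Gamma1Twin

variable {W : WeierstrassCurve ℚ} {M : ℕ} [NeZero M] (D : Gamma1ParametrizationData W M)

/-- `g₂(Λ) = c₄/12` for a `Γ₁`-datum (twin of `ModularParametrizationData.neronLattice_g₂`). [folklore] -/
theorem g1_neronLattice_g₂ : D.L.g₂ = ((((W.c₄ : ℚ) : ℝ) / 12 : ℝ) : ℂ) := by
  rw [D.isNeronLattice.1, WeierstrassCurve.baseChange, WeierstrassCurve.map_c₄, eq_ratCast]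
  push_cast
  ring

/-- `g₃(Λ) = c₆/216` for a `Γ₁`-datum (twin). [folklore] -/
theorem g1_neronLattice_g₃ : D.L.g₃ = ((((W.c₆ : ℚ) : ℝ) / 216 : ℝ) : ℂ) := by
  rw [D.isNeronLattice.2, WeierstrassCurve.baseChange, WeierstrassCurve.map_c₆, eq_ratCast]
  push_cast
  ring

/-- The lattice of a `Γ₁`-datum is real (twin of `isReal_neronLattice`). [folklore] -/
theorem g1_isReal_neronLattice : D.L.IsReal :=
  PeriodPair.isReal_of_g₂_g₃_real PeriodPair.uniformization_unique_holds
    (by rw [g1_neronLattice_g₂ D, Complex.ofReal_im]) (by rw [g1_neronLattice_g₃ D, Complex.ofReal_im])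

/-- `disc Λ = Δ(W/ℝ)` for a `Γ₁`-datum (twin of `discr_neronLattice`). [folklore] -/
theorem g1_discr_neronLattice : D.L.g₂.re ^ 3 - 27 * D.L.g₃.re ^ 2 = (W.baseChange ℝ).Δ := by
  rw [g1_neronLattice_g₂ D, g1_neronLattice_g₃ D, Complex.ofReal_re, Complex.ofReal_re,
    ← ModularParametrizationData.baseChange_real_c₄, ← ModularParametrizationData.baseChange_real_c₆,
    show ((W.baseChange ℝ).c₄ / 12) ^ 3 - 27 * ((W.baseChange ℝ).c₆ / 216) ^ 2 =
      ((W.baseChange ℝ).c₄ ^ 3 - (W.baseChange ℝ).c₆ ^ 2) / 1728 by ring,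
    ← (W.baseChange ℝ).c_relation]
  ring

/-- `Ω(W) = #π₀ · Ω₀(Λ)` for a `Γ₁`-datum (twin of `realPeriodRat_eq_numRealComponents_mul`).
[folklore] -/
theorem g1_realPeriodRat_eq [W.IsElliptic] :
    W.realPeriodRat = (W.baseChange ℝ).numRealComponents * D.L.minRealPeriod := by
  haveI : (W.baseChange ℝ).IsElliptic := by
    rw [WeierstrassCurve.baseChange]; infer_instance
  obtain ⟨L', h₂', h₃', hΩ⟩ := (W.baseChange ℝ).exists_periodPair_realPeriod_eq_holds
  have hlat : D.L.lattice = L'.lattice :=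
    PeriodPair.uniformization_unique_holds _ _
      (by rw [h₂', g1_neronLattice_g₂ D, ModularParametrizationData.baseChange_real_c₄])
      (by rw [h₃', g1_neronLattice_g₃ D, ModularParametrizationData.baseChange_real_c₆])
  rw [WeierstrassCurve.realPeriodRat_def, hΩ, PeriodPair.minRealPeriod_def, hlat]

/-- `Ω(W)/2 ∈ re Λ` for a `Γ₁`-datum, given (M-rhombic): rectangular case `Ω = 2Ω₀`, `Ω₀ ∈ Λ`;
rhombic case `Ω = Ω₀` and (M-rhombic). [folklore] -/
theorem g1_exists_re_eq_half [W.IsElliptic] (hRh : RhombicHalf) :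
    ∃ z ∈ D.L.lattice, z.re = W.realPeriodRat / 2 := by
  haveI : (W.baseChange ℝ).IsElliptic := by
    rw [WeierstrassCurve.baseChange]; infer_instance
  rw [g1_realPeriodRat_eq D]
  by_cases hΔ : 0 < (W.baseChange ℝ).Δ
  · rw [(W.baseChange ℝ).numRealComponents_of_Δ_pos hΔ]
    refine ⟨(D.L.minRealPeriod : ℂ), (g1_isReal_neronLattice D).minRealPeriod_mem_lattice, ?_⟩
    rw [Complex.ofReal_re]
    push_cast
    ring
  · rw [(W.baseChange ℝ).numRealComponents_of_Δ_nonpos (not_lt.mp hΔ)]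
    have hne : (W.baseChange ℝ).Δ ≠ 0 := (W.baseChange ℝ).isUnit_Δ.ne_zero
    have hneg : D.L.g₂.re ^ 3 - 27 * D.L.g₃.re ^ 2 < 0 := by
      rw [g1_discr_neronLattice D]
      exact lt_of_le_of_ne (not_lt.mp hΔ) hne
    obtain ⟨z, hz, hzre⟩ := hRh D.L (g1_isReal_neronLattice D) hneg
    exact ⟨z, hz, by rw [hzre]; push_cast; ring⟩

end Gamma1Twin

/-- **(β) for the `X₁(N)`-optimal curve (unconditional given the datum).** Let `E₀` (globally minimal) carry
an `X₀(N)`-datum `D₀` with odd Manin constant `c₀` (Abbes–Ullmo at `2 ∤ N`), and let `W₁` (globally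
minimal, elliptic) carry a `Γ₁(N)`-datum `D₁` with the same newform whose lattice is
*`X₁(N)`-optimal*: `Λ_{W₁} ⊆ c₁ Λ₁(f)` (Stevens 1989 §2: the `X₁(N)`-optimal curve `E₁` has
`Λ_{E₁} = c₁Λ₁(f)`). If the integer period functional `m` of `f` is Eisenstein mod `2^{s+1}`, then
`Ω(W₁) = r Ω(E₀)` with `v₂(r) ≥ s+1` — the conclusion of `stub_periodDescentOfEisenstein` with
`W₃ := W₁` for every `s` (the isogeny `E₀ ~ W₁` comes separately from
`exists_isogeny_degree_eq_of_isNeronLatticeOf` and `c₀Λ₁(f) ⊆ c₀Λ_f ⊆ Λ_{E₀}`). [folklore] -/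
theorem periodDescent_of_gamma1Optimal
    {E₀ : WeierstrassCurve ℚ} [E₀.IsElliptic] {M : ℕ} [NeZero M]
    (D₀ : ModularParametrizationData E₀ M) (hc₀ : ¬ (2 : ℤ) ∣ D₀.maninConstant)
    {W₁ : WeierstrassCurve ℚ} [W₁.IsElliptic] (D₁ : Gamma1ParametrizationData W₁ M)
    (hf : D₁.f = D₀.f)
    (hopt : ∀ z ∈ D₁.L.lattice, ∃ w ∈ periodLatticeGamma1 D₁.f, z = D₁.c * w)
    (s : ℕ) (m : Gamma0 M → ℤ)
    (hm : ∀ γ, (cuspSymbol D₀.f γ).re = m γ * (plusPeriod D₀.f / 2))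
    (χ : ZMod M → ZMod (2 ^ (s + 1)))
    (hχ : ∀ γ, ((m γ : ℤ) : ZMod (2 ^ (s + 1))) = χ (Gamma0Map M γ)) :
    ∃ r : ℚ, W₁.realPeriodRat = (r : ℝ) * E₀.realPeriodRat ∧ ((s : ℤ) + 1) ≤ padicValRat 2 r := by
  have hpos : 0 < plusPeriod D₀.f :=
    IsNewform0.plusPeriod_pos_holds D₀.isNewformOf.1 D₀.isNewformOf.coeffField_eq_bot
  obtain ⟨m₀, -, hm₀⟩ := D₀.realPeriodRat_dvd_holds
  rw [hf] at hopt
  obtain ⟨j, hj⟩ := realPeriod_eq_of_sublattice D₀.f hpos.ne' s m hm χ hχ D₁.L.lattice D₁.c hopt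
    W₁.realPeriodRat (g1_exists_re_eq_half D₁ rhombicHalf_holds)
  have hΩ₁ : W₁.realPeriodRat ≠ 0 := by
    haveI : (W₁.baseChange ℝ).IsElliptic := by
      rw [WeierstrassCurve.baseChange]; infer_instance
    rw [WeierstrassCurve.realPeriodRat_def]
    exact (W₁.baseChange ℝ).realPeriod_pos'.ne'
  exact padicValRat_ratio_ge s (plusPeriod D₀.f) E₀.realPeriodRat W₁.realPeriodRat j D₁.c
    D₀.maninConstant m₀ hj (by exact_mod_cast hm₀) hc₀ hΩ₁

#print axioms periodDescent_of_gamma1Optimal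

/-- **The `X₁(N)`-lattice-optimal curve is `ℚ`-isogenous to `E₀`**: `(c₀/c₁) Λ_{W₁} = c₀ Λ₁(f)
⊆ c₀ Λ_f ⊆ Λ_{E₀}` is a rational lattice inclusion, hence a `ℚ`-isogeny `W₁ → E₀`
(`exists_isogeny_degree_eq_of_isNeronLatticeOf`, Silverman AEC VI.4.1(b)), and isogeny is symmetric
in characteristic `0` (`IsIsogenous.symm_of_charZero`). [folklore] -/
theorem isIsogenous_of_gamma1Optimal
    {E₀ : WeierstrassCurve ℚ} [E₀.IsElliptic] {M : ℕ} [NeZero M]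
    (D₀ : ModularParametrizationData E₀ M)
    {W₁ : WeierstrassCurve ℚ} [W₁.IsElliptic] (D₁ : Gamma1ParametrizationData W₁ M)
    (hf : D₁.f = D₀.f)
    (hopt : ∀ z ∈ D₁.L.lattice, ∃ w ∈ periodLatticeGamma1 D₁.f, z = D₁.c * w) :
    IsIsogenous E₀ W₁ := by
  have hc₁ : D₁.c ≠ 0 := by
    intro h0
    have hmem := (g1_isReal_neronLattice D₁).minRealPeriod_mem_lattice
    obtain ⟨w, -, hw⟩ := hopt _ hmem
    rw [h0, Int.cast_zero, zero_mul, Complex.ofReal_eq_zero] at hw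
    exact (g1_isReal_neronLattice D₁).minRealPeriod_pos.ne' hw
  have hc : ((D₀.c : ℚ) / (D₁.c : ℚ)) ≠ 0 :=
    div_ne_zero (Int.cast_ne_zero.mpr D₀.maninConstant_ne_zero_holds) (Int.cast_ne_zero.mpr hc₁)
  have hle : ∀ z ∈ D₁.L.lattice, ((((D₀.c : ℚ) / (D₁.c : ℚ) : ℚ)) : ℂ) * z ∈ D₀.L.lattice := by
    intro z hz
    obtain ⟨w, hw, rfl⟩ := hopt z hz
    rw [hf] at hw
    have h := ModularParametrizationData.smul_periodLatticeGamma1_le E₀ M D₀ w hw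
    have hc₁' : (D₁.c : ℂ) ≠ 0 := Int.cast_ne_zero.mpr hc₁
    convert h using 1
    push_cast
    field_simp
  obtain ⟨φ, -⟩ := exists_isogeny_degree_eq_of_isNeronLatticeOf W₁ E₀ D₁.isNeronLattice
    D₀.isNeronLattice hc hle
  exact IsIsogenous.symm_of_charZero ⟨φ⟩

#print axioms isIsogenous_of_gamma1Optimal

/-! ### GEN 11 — the registered stub VERBATIM modulo T2 (the `X₁(N)`-optimal datum exists) -/

section Gen11

open Literature.NumberTheory.EllipticCurves.Rank1Residual
  Literature.NumberTheory.EllipticCurves.Greenberg1999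

/-- **T2 — Stevens' `X₁(N)`-optimal curve, as a `Γ₁(N)`-datum (print-existence statement).** For
every globally minimal elliptic `E₀/ℚ` carrying an `X₀(N)`-parametrisation datum `D₀` at its
conductor level `N` (so `D₀.f` is the newform of the class), there is a globally minimal elliptic
`W₁/ℚ` with a `Γ₁(N)`-parametrisation datum `D₁` with THE SAME newform whose Néron lattice is
`X₁(N)`-optimal: `Λ_{W₁} ⊆ c₁ Λ₁(f)` (hence `= c₁Λ₁(f)`, as `c₁Λ₁(f) ⊆ Λ_{W₁}` is a field of the
datum). Witness in print: the optimal (connected-kernel) quotient `J₁(N) ↠ E₁` attached to `f`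
(Shimura; Stevens 1989 §2, "the `X₁(N)`-optimal curve"), `H₁(X₁(N), ℤ) ↠ H₁(E₁, ℤ)`, so the
Néron lattice of the minimal model of `E₁` is `c₁ · Λ₁(f)` with `c₁ = c_φ ∈ ℤ` (Gabber;
Česnavičius–Neururer–Saha, JEMS 26 (2024) §1 and Lemma `const-in-Z`: "one knows that `c_φ ∈ ℤ`"
for every surjection `(X_Γ)_ℚ ↠ E`, `Γ₁(N) ⊂ Γ ⊂ Γ₀(N)`). NOT Stevens' conjecture (`c₁ = ±1`,
`E₁` of minimal Faltings height) and NOT its `2`-part (Vatsal 2005 Thm. 1.10): only existence +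
integrality. Shared with crux 27047's stub T2. [cite: Stevens1989, §2; CesnaviciusNeururerSaha2023, §1 (const-in-Z)] -/
def Gamma1OptimalDatumExists : Prop :=
  ∀ (E₀ : WeierstrassCurve ℚ) [E₀.IsElliptic] [E₀.IsGloballyMinimal] [NeZero (E₀.conductorNorm ℤ)]
    (D₀ : ModularParametrizationData E₀ (E₀.conductorNorm ℤ)),
    ∃ (W₁ : WeierstrassCurve ℚ) (_ : W₁.IsElliptic) (_ : W₁.IsGloballyMinimal)
      (D₁ : Gamma1ParametrizationData W₁ (E₀.conductorNorm ℤ)),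
      D₁.f = D₀.f ∧ ∀ z ∈ D₁.L.lattice, ∃ w ∈ periodLatticeGamma1 D₁.f, z = D₁.c * w

/-- **Skeleton v11's `stub_periodDescentOfEisenstein`, VERBATIM, from T2.** The statement below is
the registered stub's type token for token (line `Lines/kato_free_lower_sandwich_two.lean` v11,
sha256 `4aad1e715c35…`, ll. 167–181); the proof is `Gamma1OptimalDatumExists` + the GEN 10 glue
(`isIsogenous_of_gamma1Optimal`, `periodDescent_of_gamma1Optimal`) with `W₃ := W₁` for every `s`,
`2 ∤ N` from `GoodOrd E₀ 2` and `2 ∤ c₀` from the Abbes–Ullmo binder applied to the stub's own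
lattice-optimality hypothesis. Unused binders: PUB, `¬CM`, `analyticRank = 0`, the `2`-torsion
member. [folklore] -/
theorem stub_periodDescentOfEisenstein_of_T2 (hT2 : Gamma1OptimalDatumExists) :
    Literature.Uncategorized.OrdPublishedInputsAtTwo →
    abbesUllmo_not_dvd_maninConstant_of_not_dvd_level →
    ∀ (E₀ : WeierstrassCurve ℚ) [E₀.IsElliptic] [E₀.IsGloballyMinimal] [NeZero (E₀.conductorNorm ℤ)]
      (D₀ : ModularParametrizationData E₀ (E₀.conductorNorm ℤ)),
      (∀ z ∈ D₀.L.lattice, ∃ w ∈ periodLattice D₀.f, z = D₀.c * w) →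
      ¬ E₀.HasCM → E₀.analyticRank = 0 → GoodOrd E₀ 2 →
      (∃ (W₁ : WeierstrassCurve ℚ) (_ : W₁.IsElliptic) (_ : W₁.IsGloballyMinimal),
        IsIsogenous E₀ W₁ ∧ ∃ x : ℚ, HasRationalTwoTorsionX W₁ x) →
      ∀ (s : ℕ) (m : Gamma0 (E₀.conductorNorm ℤ) → ℤ),
        (∀ γ, (cuspSymbol D₀.f γ).re = m γ * (plusPeriod D₀.f / 2)) →
      ∀ χ : ZMod (E₀.conductorNorm ℤ) → ZMod (2 ^ (s + 1)),
        (∀ γ, ((m γ : ℤ) : ZMod (2 ^ (s + 1))) = χ (Gamma0Map (E₀.conductorNorm ℤ) γ)) →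
      ∃ (W₃ : WeierstrassCurve ℚ) (_ : W₃.IsElliptic) (_ : W₃.IsGloballyMinimal),
        IsIsogenous E₀ W₃ ∧ ∃ r : ℚ, W₃.realPeriodRat = (r : ℝ) * E₀.realPeriodRat ∧ ((s : ℤ) + 1) ≤ padicValRat 2 r := by
  intro _hP hAU E₀ _ _ _ D₀ hopt₀ _hCM _hr hgo _h2 s m hm χ hχ
  obtain ⟨W₁, hW₁e, hW₁m, D₁, hf, hopt⟩ := hT2 E₀ D₀
  have hN : ¬ 2 ∣ E₀.conductorNorm ℤ :=
    haveI : Fact (Nat.Prime 2) := ⟨Nat.prime_two⟩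
    not_dvd_conductorNorm_of_hasGoodReductionAtPrime E₀ hgo.1
  have hc₀ : ¬ (2 : ℤ) ∣ D₀.maninConstant := hAU E₀ D₀ hopt₀ 2 Nat.prime_two hN
  exact ⟨W₁, hW₁e, hW₁m, isIsogenous_of_gamma1Optimal D₀ D₁ hf hopt,
    periodDescent_of_gamma1Optimal D₀ hc₀ D₁ hf hopt s m hm χ hχ⟩

#print axioms stub_periodDescentOfEisenstein_of_T2

end Gen11

end Summit.BirchSwinnertonDyer.BirchSwinnertonDyer.Cruxes.OrdMissingLowerBoundAtTwo.TriageR11BetaViaE1
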